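import Summits.BirchSwinnertonDyer.BirchSwinnertonDyer.Theorems.SchneiderFreeAdditiveX3BranchIMCRebaseArtinRoad
import Literature.NumberTheory.EllipticCurves.RankinSelbergGenusTwist
import Literature.NumberTheory.Automorphic.BCDTModularitySemistableTwistProofs
import Literature.NumberTheory.EllipticCurves.PAdicGrossZagierConstantTermProofs
import Literature.FieldTheory.Galois.SolvableCompositum
import HarnessLib

/-!
# Route `SchneiderFreeAdditiveX3` (K1 door) / wing: the twist identity `L(f′/K, χ_ε φ, s₀) = L(f/K, φ, s₀)` for the DOOR'S
# PRESENTATION `W = C₂ • ((D • W′) ⊗ χ_{p*})` with every side condition DISCHARGED (`a_p(f) = 0`, `p ∣ N`, equal prime support of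
# the levels off `p`, `p` unramified in `K`)

Cell `bsd-schneider-ideate`, seat `bsd-schneider-door-c5` (prover, generation 19; assembly layer).  PARTITION: board row
B6 ∩ X3 ∩ sst-twist, `r = 1`, (G-ord, `e = 2`) half, of `Rank1Residual.partition`; types-the-object-of nothing new; closes none of B6's
cells.  bears_on: K1-door r3 `GordTwoBranchIMC` (19177) / K1-wing r3 `GordTwoBranchCoIMCField` (20365) — FINDING-door-c5-g19 §2b: input
(M1) of the matching of a Keller–Yin branch frame with a ♭-frame of `f_E`, in the shape the per-datum assembler holds.

This seat's `Literature/…/RankinSelbergGenusTwist.lean` (p633239) proves the identity for newforms `f`, `f′` under four side conditions.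
For the door's presentation (door-c3's rebased road: `W′` with GOOD reduction at the odd prime `p`, `W = C₂ • ((D • W′) ⊗ χ_{p*})`,
parametrisation data `Dt` of `W` (level `N`) and `Dt′` of `W′` (level `N′`)) the four conditions are TREE THEOREMS:
* `cuspCoeff_prime_eq_zero_of_presentation` — `a_p(Dt.f) = 0`: `a_n(Dt.f) = a_n(W)` (`IsNewformOf`), `a_n` is a `ℚ`-isomorphism
  invariant (`LFunction_smul`), `a_p((D • W′) ⊗ χ_{p*}) = (p/p)·a_p(D • W′) = 0` (`BCDT.LFunction_quadraticTwist_pStar_apply_complex_of_not_dvd`,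
  `p ∤ N_{W′}`);
* `prime_dvd_level_of_presentation` (door-c3, p ∣ N) and `dvd_level_iff_dvd_level_partner_of_presentation` — `ℓ ∣ N ↔ ℓ ∣ N′` for
  primes `ℓ ≠ p` (`IsNewformOf.dvd_level_iff_dvd_conductorNorm` twice and `N_W = N_{W′}·p²`, `conductorNorm_presentation_eq`, which consumes
  modularity as `exists_isNewformOf`);
* `isUnramifiedIn_of_splitsTwo` — a prime with two primes above it in a quadratic field is unramified (Dedekind).
Whence `rankinSelbergValueHecke_presentation_twist_eq_of_goodPartner`: for `K` imaginary quadratic with `p` split and every `φ`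
unramified at all finite places, `L(Dt′.f/K, χ_ε φ, s₀) = L(Dt.f/K, φ, s₀)` — no side condition left.

HONEST FRAMING: THEOREMS ONLY (no definition, no named fact, no `sorry`); CONDITIONAL on modularity in the form `exists_isNewformOf` where
displayed; nothing asserted about BSD or about Keller–Yin's preprint; serves 19177 / 20365 as a helper, closes nothing.
References: [Gross2004] §3 p. 40; [AtkinLehner1970] §6 (conductor of a twist); [SilvermanAEC2009] X.2 Exercise 10.16; [DiamondShurman2005]
Prop. 5.8.5; [KellerYin2024b] arXiv:2410.23241 Prop. 3.1.3 (shape; preprint).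
-/

set_option autoImplicit false
-- `Summit.<P>.<Sub>` repeats `BirchSwinnertonDyer` by the tree's layout convention (D-0017)
set_option linter.dupNamespace false

noncomputable section

open scoped Classical NumberField

open Field NumberField IsDedekindDomain WeierstrassCurve CongruenceSubgroup
  Literature.NumberTheory.EllipticCurves Literature.NumberTheory.GaloisRepresentations
  Literature.NumberTheory.EllipticCurves.ModularForms Literature.NumberTheory.EllipticCurves.KellerYin2024
  Summit.BirchSwinnertonDyer.Rank1Residual Summit.BirchSwinnertonDyer.BirchSwinnertonDyer.Theorems.SchneiderFree

namespace Summit.BirchSwinnertonDyer.BirchSwinnertonDyer.Theorems.SchneiderFreeAdditiveX3.ControlDischarged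

variable {p : ℕ} [Fact p.Prime]

/-! ### §1 The side conditions for the door's presentation -/

/-- **`a_p(f) = 0` for the newform of the door's curve `W = C₂ • ((D • W′) ⊗ χ_{p*})`** (`W′` good at the odd prime `p`): the
coefficient is `a_p(W) = a_p((D • W′) ⊗ χ_{p*}) = (p/p)·a_p(D • W′) = 0`. [cite: SilvermanAEC2009, X.2 Exercise 10.16]
[cite: AtkinLehner1970, §6 (a twist by a character of conductor p is p-new: a_p = 0)] -/
theorem cuspCoeff_prime_eq_zero_of_presentation (hp2 : p ≠ 2) (W' : WeierstrassCurve ℚ) [W'.IsElliptic]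
    (hgood : W'.HasGoodReductionAtPrime p) (D C₂ : VariableChange ℚ)
    [(C₂ • (D • W').quadraticTwist ((-1 : ℚ) ^ (p / 2) * p)).IsElliptic] {N : ℕ} [NeZero N]
    (Dt : ModularParametrizationData (C₂ • (D • W').quadraticTwist ((-1 : ℚ) ^ (p / 2) * p)) N) :
    cuspCoeff Dt.f p = 0 := by
  have hp : p.Prime := Fact.out
  have hd0 : ((-1 : ℚ) ^ (p / 2) * p) ≠ 0 :=
    mul_ne_zero (pow_ne_zero _ (by norm_num)) (by exact_mod_cast hp.ne_zero)
  haveI : ((D • W').quadraticTwist ((-1 : ℚ) ^ (p / 2) * p)).IsElliptic := (D • W').isElliptic_quadraticTwist hd0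
  have hpN' : ¬ p ∣ (D • W').conductorNorm ℤ := by
    rw [WeierstrassCurve.conductorNorm_int_smul]
    exact not_dvd_conductorNorm_of_hasGoodReductionAtPrime W' hgood
  have hcast : (((-1 : ℤ) ^ (p / 2) * p : ℤ) : ℚ) = (-1 : ℚ) ^ (p / 2) * p := by push_cast; ring
  have htw := Literature.NumberTheory.Automorphic.BCDT.LFunction_quadraticTwist_pStar_apply_complex_of_not_dvd (D • W') hp2 hpN' p
  rw [hcast, quadraticChar_ringHomComp_apply_natCast, (legendreSym.eq_zero_iff p (p : ℤ)).mpr (by simp),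
    Int.cast_zero, zero_mul] at htw
  rw [Dt.isNewformOf.2 p, WeierstrassCurve.LFunction_smul, htw]

/-- **`ℓ ∣ N ↔ ℓ ∣ N′` for primes `ℓ ≠ p`** — the levels of the data of the door's curve `W = C₂ • ((D • W′) ⊗ χ_{p*})` and of its good
partner `W′` have the same prime divisors off `p` (`N = N_W = N_{W′}·p²`, `N′ = N_{W′}`).  CONDITIONAL on modularity (`exists_isNewformOf`,
consumed by `conductorNorm_presentation_eq`). [cite: AtkinLehner1970, §6] [cite: DiamondShurman2005, Prop. 5.8.5 and (8.44)] -/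
theorem dvd_level_iff_dvd_level_partner_of_presentation (hmodN : exists_isNewformOf) (hp2 : p ≠ 2)
    (W' : WeierstrassCurve ℚ) [W'.IsElliptic] (hgood : W'.HasGoodReductionAtPrime p) (D C₂ : VariableChange ℚ)
    [(C₂ • (D • W').quadraticTwist ((-1 : ℚ) ^ (p / 2) * p)).IsElliptic] {N : ℕ} [NeZero N]
    (Dt : ModularParametrizationData (C₂ • (D • W').quadraticTwist ((-1 : ℚ) ^ (p / 2) * p)) N)
    {N' : ℕ} [NeZero N'] (Dt' : ModularParametrizationData W' N') {ℓ : ℕ} (hℓ : ℓ.Prime) (hℓp : ℓ ≠ p) :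
    ℓ ∣ N ↔ ℓ ∣ N' := by
  have hp : p.Prime := Fact.out
  rw [Dt.isNewformOf.dvd_level_iff_dvd_conductorNorm hℓ, Dt'.isNewformOf.dvd_level_iff_dvd_conductorNorm hℓ,
    conductorNorm_presentation_eq hmodN hp2 W' hgood D C₂]
  refine ⟨fun h ↦ ?_, fun h ↦ h.mul_right _⟩
  rcases (Nat.Prime.dvd_mul hℓ).mp h with h1 | h2
  · exact h1
  · exact absurd ((Nat.prime_dvd_prime_iff_eq hℓ hp).mp (hℓ.dvd_of_dvd_pow h2)) hℓp

/-- **A rational prime with two primes above it in a quadratic field is unramified there** (fundamental identity + Dedekind's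
discriminant theorem). [cite: NeukirchANT1999, Ch. I §8 (8.2) and Ch. III §2 (2.12)] -/
theorem isUnramifiedIn_of_splitsTwo {K : Type} [Field K] [NumberField K] (hK : IsImaginaryQuadratic K)
    (hsplit : ((Ideal.span {(p : ℤ)}).primesOver (𝓞 K)).ncard = 2) :
    Algebra.IsUnramifiedIn (𝓞 K) (Ideal.span {(p : ℤ)}) := by
  have hp : p.Prime := Fact.out
  exact (NumberField.not_dvd_discr_iff_isUnramifiedIn K (𝓞 K) (Nat.prime_iff_prime_int.mp hp)).mp
    (not_dvd_discr_of_ncard_primesOver hp (hsplit.trans hK.1.symm))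

/-! ### §2 The twist identity for the presentation, side conditions discharged -/

/-- **`L(Dt′.f/K, χ_ε φ, s₀) = L(Dt.f/K, φ, s₀)` for the door's presentation** — `W′` good at the odd prime `p`, `W = C₂ • ((D • W′) ⊗
χ_{p*})`, `K` imaginary quadratic with `p` split, `φ` unramified at all finite places, any `s₀`; the four side conditions of
`rankinSelbergValueHecke_presentation_twist_eq` are §1.  CONDITIONAL on modularity (`exists_isNewformOf`); this is input (M1) of the
Keller–Yin ↔ ♭-frame matching in the per-datum shape (FINDING-door-c5-g19 §2b). [cite: Gross2004, §3 (p. 40)]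
[cite: KellerYin2024b, Prop. 3.1.3 and §3.4 (arXiv:2410.23241 pp. 14, 19) (shape; preprint)] -/
theorem rankinSelbergValueHecke_presentation_twist_eq_of_goodPartner (hmodN : exists_isNewformOf) (hp2 : p ≠ 2)
    (W' : WeierstrassCurve ℚ) [W'.IsElliptic] (hgood : W'.HasGoodReductionAtPrime p) (D C₂ : VariableChange ℚ)
    [(C₂ • (D • W').quadraticTwist ((-1 : ℚ) ^ (p / 2) * p)).IsElliptic] {N : ℕ} [NeZero N]
    (Dt : ModularParametrizationData (C₂ • (D • W').quadraticTwist ((-1 : ℚ) ^ (p / 2) * p)) N)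
    {N' : ℕ} [NeZero N'] (Dt' : ModularParametrizationData W' N')
    {K : Type} [Field K] [NumberField K] [IsGalois ℚ K] (hK : IsImaginaryQuadratic K)
    (hsplit : ((Ideal.span {(p : ℤ)}).primesOver (𝓞 K)).ncard = 2)
    {φ : HeckeCharacter K} (hφ : ∀ v : HeightOneSpectrum (𝓞 K), φ.IsUnramifiedAt v) (s₀ : ℂ) :
    rankinSelbergValueHecke Dt'.f (genusHeckeCharacter K p * φ) s₀ = rankinSelbergValueHecke Dt.f φ s₀ :=
  rankinSelbergValueHecke_presentation_twist_eq K hp2 (isUnramifiedIn_of_splitsTwo hK hsplit) W' D C₂ Dt.isNewformOf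
    Dt'.isNewformOf (cuspCoeff_prime_eq_zero_of_presentation hp2 W' hgood D C₂ Dt)
    (prime_dvd_level_of_presentation hmodN hp2 W' hgood D C₂ Dt)
    (fun _ hℓ hℓp ↦ dvd_level_iff_dvd_level_partner_of_presentation hmodN hp2 W' hgood D C₂ Dt Dt' hℓ hℓp) hφ s₀

end Summit.BirchSwinnertonDyer.BirchSwinnertonDyer.Theorems.SchneiderFreeAdditiveX3.ControlDischarged

end
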